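import Literature.Probability.RandomPlanarGeometry.SLEKappaRhoSchrammObservable
import HarnessLib

/-!
# Schramm's left-passage formula for chordal SLE (named facts)

Topic `Literature/Probability/RandomPlanarGeometry`. Vendors, as `Prop`-valued named facts in the
idiom of `SLEKappaRhoSchrammObservable.lean` (`Loewner.PassesLeft`, `Loewner.PassesRight`,
`schrammH`, `sleDriving`, the pre-Wiener measure), the two printed statements of

* O. Schramm, *A percolation formula*, Electron. Comm. Probab. **6** (2001) 115–120
  (arXiv:math/0107096), **Theorem 2**: "Let `κ ∈ [0,8)`, and let `z₀ = x₀ + i y₀ ∈ ℍ`. Then the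
  trace `γ` of chordal SLE_κ satisfies
  `P[γ passes to the left of z₀] = ½ + Γ(4/κ)/(√π Γ((8−κ)/(2κ))) · (x₀/y₀) · ₂F₁(½, 4/κ; 3/2; −x₀²/y₀²)`.
  When `κ = 2, 8/3, 4` and `8` the right hand side simplifies to `1 + x₀y₀/(π|z₀|²) − arg z₀/π`,
  `½ + x₀/|z₀|` [sic — the general formula gives `½ + x₀/(2|z₀|)` at `κ = 8/3`:
  `Γ(3/2)/(√π Γ(1)) = ½` and `₂F₁(½, 3/2; 3/2; −w²) = (1 + w²)^{−1/2}`], `1 − arg z₀/π` and `½`,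
  respectively"; **Lemma 3**: "Almost surely, `γ` is to the left [respectively, right] of `z₀`
  if `lim_{t↑τ(z₀)} w_t = ∞` [respectively, `−∞`]" (`w_t = x_t/y_t`,
  `x_t + i y_t = g_t(z₀) − W(t)`); and the **proof of Theorem 2** (arXiv p. 3): after the time
  change `u(t) = ∫₀ᵗ ds/y_s²` the slope is the diffusion `dw = −dW̃ + 4w du/(w² + 1)`, "the
  diffusion process (5) is transient. Moreover,
  `P[lim_{u→∞} w_u = +∞] = (f(w₀) − f(−∞))/(f(∞) − f(−∞))`,
  `f(w) := ₂F₁(1/2, 4/κ, 3/2, −w²) w`. An appeal to the lemma now completes the proof."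

The tree already has Schramm's function `schrammH w = (1 + w/√(1 + w²))/2` (the right hand side
at `κ = 8/3`: `½ + x₀/(2|z₀|) = h(x₀/y₀)`), the passage events in Schramm's dynamical form
(`Loewner.PassesLeft W z` := `w_t → +∞` as `t ↑ T_z`; `Loewner.PassesRight`), Schramm's
martingale PROVED for every `z ∈ ℍ` (`martingale_schrammObsStopped_sle`, `SLESchrammMartingale`)
and the dominated-convergence assembly `measureReal_passesLeft_eq`, which together give the
`κ = 8/3` formula CONDITIONALLY on the dichotomy `w_t → ±∞` a.s. (hypothesis `hd` of
`measureReal_passesLeft_sle_eq_half`). What is NOT in the tree, and is vendored here: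

* `Schramm2001_slope_dichotomy` — the transience sentence of the proof of Thm. 2 (with Lemma 3):
  for `0 < κ < 8` and `z₀ ∈ ℍ`, almost surely `w_t → +∞` or `w_t → −∞` as `t ↑ τ(z₀)`. This is
  exactly the hypothesis `hd` above; `κ = 0` is excluded (for `x₀ = 0` the deterministic slope
  stays `0`: the vertical trace hits `z₀`; Schramm uses "`κ ∈ (0,8)` … `P[z₀ ∈ γ[0,∞)] = 0`").
* `Schramm2001_passesLeft_eightThirds` — Theorem 2 at `κ = 8/3`, in the dynamical form the proof
  establishes: `P[w_t → +∞] = h(x₀/y₀) = ½ + x₀/(2|z₀|) = (1 + cos arg z₀)/2`.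

Use: grounds the support statement `StretchRigidity` of route SAWBrickWallHomotopy
(`Summit.CriticalPhenomena.SAWScalingLimit.Theses.SAWBrickWallHomotopy.StretchRigidity`: chordal
SLE_{8/3} admits no axis-stretch covariance `(x, y) ↦ (x, s y)`, `s ≠ 1`): the stretch fixes
`(ℍ; 0, ∞)` and maps the ray `arg z = θ` to the ray `arg z = θ'` with `cot θ' = cot θ / s`, while
the left-passage probability `(1 + cos θ)/2` is a strictly monotone function of the ray — an
explicit, non-affine-invariant statistic of the SLE_{8/3} law (to be transported to bounded
Dobrushin domains by `IsSLELaw.conformalCovariance_of_facts`). No printed source states the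
stretch non-covariance itself as a theorem (Beffara 2008, arXiv:0708.3908, Introduction p. 2,
remarks informally that the linear image of a conformally invariant scaling limit "obviously … is
not rotationally invariant").

Users take `(h : Schramm2001_slope_dichotomy)` / `(h : Schramm2001_passesLeft_eightThirds)` as
hypotheses; nothing is asserted.
-/

noncomputable section

open MeasureTheory Complex
open scoped NNReal
open Literature.Probability.Process (preWienerMeasure)

namespace Literature.Probability.RandomPlanarGeometry

/-- NAMED FACT — **Schramm 2001, proof of Theorem 2 (transience of the slope diffusion) with
Lemma 3**: for `0 < κ < 8` and `z₀ = x₀ + i y₀ ∈ ℍ`, writing `x_t + i y_t = g_t(z₀) − W(t)`,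
`w_t = x_t/y_t` for the chordal SLE_κ Loewner chain (`W = √κ B`), almost surely
`w_t → +∞` or `w_t → −∞` as `t ↑ τ(z₀)` ("the diffusion process `dw = −dW̃ + 4w du/(w² + 1)`
is transient … `P[lim_{u→∞} w_u = +∞] = (f(w₀) − f(−∞))/(f(∞) − f(−∞))`"; by Lemma 3 the two
events are "`γ` passes to the left / to the right of `z₀`"). In the tree's notation: a.s.
`Loewner.PassesLeft` or `Loewner.PassesRight` for the SLE_κ driving function — the dichotomy
hypothesis `hd` of `measureReal_passesLeft_sle_eq_half`.
[cite: Schramm2001Percolation, Thm. 2 (proof, "the diffusion process is transient") and Lemma 3] -/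
def Schramm2001_slope_dichotomy : Prop :=
  ∀ (κ : ℝ≥0), 0 < κ → κ < 8 → ∀ z : ℂ, 0 < z.im →
    ∀ᵐ ω ∂preWienerMeasure,
      Loewner.PassesLeft (fun s ↦ sleDriving κ ω s) z ∨
        Loewner.PassesRight (fun s ↦ sleDriving κ ω s) z

/-- NAMED FACT — **Schramm 2001, Theorem 2 at `κ = 8/3` (Schramm's left-passage formula)**:
"Let `κ ∈ [0,8)`, and let `z₀ = x₀ + i y₀ ∈ ℍ`. Then the trace `γ` of chordal SLE_κ satisfies
`P[γ passes to the left of z₀] = ½ + Γ(4/κ)/(√π Γ((8−κ)/(2κ))) (x₀/y₀) ₂F₁(½, 4/κ; 3/2; −x₀²/y₀²)`",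
which at `κ = 8/3` (`Γ(3/2)/(√π Γ(1)) = ½`, `₂F₁(½, 3/2; 3/2; −w²) = (1 + w²)^{−1/2}`) is
`½ + x₀/(2|z₀|) = h(x₀/y₀)` with the tree's `schrammH w = (1 + w/√(1 + w²))/2` (the paper
prints the simplified value as "`½ + x₀/|z₀|`"). Stated in the dynamical form the proof
establishes (`P[lim w = +∞] = (f(w₀) − f(−∞))/(f(∞) − f(−∞))`, Lemma 3 identifying this event
with left passage): the pre-Wiener measure of `Loewner.PassesLeft` for the SLE_{8/3} driving
function equals `schrammH (x₀/y₀)`. The case `z₀ = i` (value `½`) is the tree's conditional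
theorem `measureReal_passesLeft_sle_eq_half`.
[cite: Schramm2001Percolation, Thm. 2 (κ = 8/3) with Lemma 3 and the proof of Thm. 2] -/
def Schramm2001_passesLeft_eightThirds : Prop :=
  ∀ z : ℂ, 0 < z.im →
    preWienerMeasure.real
        {ω | Loewner.PassesLeft (fun s ↦ sleDriving ((8 : ℝ≥0) / 3) ω s) z} =
      schrammH (z.re / z.im)

/-- Sanity check of the vendored right hand side: at `z₀ = i` (slope `0`) Schramm's value is
`h(0) = ½`, the value of the tree's `measureReal_passesLeft_sle_eq_half`.
[cite: Schramm2001Percolation, Thm. 2 (κ = 8/3)] -/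
theorem Schramm2001_passesLeft_eightThirds.apply_I (h : Schramm2001_passesLeft_eightThirds) :
    preWienerMeasure.real
        {ω | Loewner.PassesLeft (fun s ↦ sleDriving ((8 : ℝ≥0) / 3) ω s) Complex.I} = 1 / 2 := by
  have := h Complex.I (by simp)
  simpa [schrammH] using this

/-- The vendored right hand side is NOT invariant under the axis stretch `(x, y) ↦ (x, s y)` of
`ℍ` unless `s = 1`: `h(w/s) = h(w)` for the slope `w = 1` forces `s = 1` (strict monotonicity
of `w ↦ w/√(1 + w²)`). This is the elementary half of the use made of the fact in route
SAWBrickWallHomotopy (`StretchRigidity`). [folklore] -/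
theorem schrammH_div_eq_iff {s : ℝ} (hs : 0 < s) : schrammH (1 / s) = schrammH 1 ↔ s = 1 := by
  refine ⟨fun h => ?_, by rintro rfl; simp⟩
  set a : ℝ := 1 / s with ha
  have ha0 : 0 < a := by positivity
  have hA : Real.sqrt (1 + a ^ 2) ^ 2 = 1 + a ^ 2 := Real.sq_sqrt (by positivity)
  have hB : Real.sqrt (1 + (1 : ℝ) ^ 2) ^ 2 = 1 + (1 : ℝ) ^ 2 := Real.sq_sqrt (by positivity)
  have hApos : 0 < Real.sqrt (1 + a ^ 2) := Real.sqrt_pos.2 (by positivity)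
  have hBpos : 0 < Real.sqrt (1 + (1 : ℝ) ^ 2) := Real.sqrt_pos.2 (by positivity)
  have h1 : a / Real.sqrt (1 + a ^ 2) = 1 / Real.sqrt (1 + (1 : ℝ) ^ 2) := by
    have := congrArg (fun x => 2 * x - 1) h
    simp only [schrammH] at this
    linarith
  have h2 : a * Real.sqrt (1 + (1 : ℝ) ^ 2) = Real.sqrt (1 + a ^ 2) := by
    rw [div_eq_div_iff hApos.ne' hBpos.ne'] at h1
    linarith
  have h3 : a ^ 2 = 1 := by
    have := congrArg (fun x => x ^ 2) h2
    simp only [mul_pow] at this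
    rw [hA, hB] at this
    nlinarith [this]
  have h4 : a = 1 := (pow_eq_one_iff_of_nonneg ha0.le (by norm_num)).1 h3
  have h5 : (1 : ℝ) / s = 1 := by rw [← ha]; exact h4
  field_simp at h5
  linarith

end Literature.Probability.RandomPlanarGeometry
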